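import Literature.Geometry.Lorentzian.KerrCarterFrequencyIdentity
import Literature.Analysis.FunctionSpaces.LpPathRegularSelection
import Mathlib.MeasureTheory.Measure.SeparableMeasure
import HarnessLib

/-!
# Carter's radial ODE in the star chart: `C²` mode coefficients for a.e. frequency

Dafermos–Rodnianski–Shlapentokh-Rothman, arXiv:1402.7034, Prop. 5.2.1 with Lemma 5.4.1: for a
sufficiently integrable `Ψ`, the coefficients of its expansion in oblate spheroidal harmonics
after a Fourier transform in time are, for a.e. frequency, `C²` functions of `r` solving the
separated radial ODE classically. This file proves that statement in the tree's coordinates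
`(t*, r, θ, φ*)` (the `*`-chart form of the ODE; the passage to DRSR's normal form (36) in `r*`
is a further explicit substitution):

* `Kerr.eqOn_Ioo_of_rat` — two functions continuous on an open interval that agree at its
  rational points agree everywhere (the countable-radius trick);
* **`Kerr.carter_radial_ode_star`** (main): for `Φ ∈ C⁴(ℝ⁴)`, `F = Φ ∘ κ_a`, a source `W ∈ C²`
  equal to the separated right-hand side off the poles, under time square-integrability of the
  relevant coordinate derivatives with uniform-in-`r` bounds, and `0 < r_a ≤ r_b`: there are
  jointly measurable representatives `u, u₁, u₂, w : ℝ → ℝ → 𝓚` of the frequency classes of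
  `F, ∂₁F, ∂₁²F, W` on `[r_a, r_b]` such that for a.e. `ξ` (`ω = -2πξ`, `ν = aω`):
  `r ↦ u r ξ` is `C²` on `(r_a, r_b)` with derivatives `u₁ · ξ`, `u₂ · ξ`, `w · ξ` is continuous,
  and for **every** index `q` and **every** `r ∈ (r_a, r_b)` the mode coefficient
  `c(r) = ⟪Ψ_q(ν), u r ξ⟫` satisfies
  `Δ c'' + (2(r - M) + 2i(am - 2Mrω)) c' + (ω²(r² + 2Mr) - 2iMω - λ_q(ν)) c = ⟪Ψ_q(ν), w r ξ⟫`.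

Proof: `freqLp F` is `C³` in `r` as an `L²(ℝ_ξ; 𝓚)`-valued map (`hasDerivAt_freqLp`), so
`exists_rep_deriv_two` gives the representatives; `carter_frequency_identity` gives the identity
at each rational radius for a.e. `ξ`; continuity in `r` of both sides extends it to all radii.

## References

* M. Dafermos, I. Rodnianski, Y. Shlapentokh-Rothman, arXiv:1402.7034, Prop. 5.2.1, Lemma 5.4.1.
  [DafermosRodnianskiShlapentokhrothman2014]
-/

noncomputable section

open Real Set Filter MeasureTheory Function
open scoped Topology ENNReal InnerProductSpace ComplexConjugate FourierTransform

namespace Literature.Geometry.Lorentzian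

namespace Kerr

open Literature.Analysis.SpecialFunctions Literature.Analysis.FunctionSpaces
  Literature.Analysis.Fourier

/-! ### The countable-radius trick -/

/-- Two functions continuous on `(a, b)` that agree at its rational points agree on `(a, b)`.
[folklore] -/
theorem eqOn_Ioo_of_rat {E : Type*} [TopologicalSpace E] [T2Space E] {f g : ℝ → E} {a b : ℝ}
    (hf : ContinuousOn f (Ioo a b)) (hg : ContinuousOn g (Ioo a b))
    (h : ∀ q : ℚ, (q : ℝ) ∈ Ioo a b → f q = g q) : ∀ r ∈ Ioo a b, f r = g r := by
  intro r hr
  -- a sequence of rationals in `(r, b)` tending to `r`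
  have hseq : ∀ n : ℕ, ∃ q : ℚ, r < q ∧ (q : ℝ) < min b (r + 1 / (n + 1)) := fun n ↦
    exists_rat_btwn (lt_min hr.2 (by linarith [(Nat.one_div_pos_of_nat : 0 < 1 / ((n : ℝ) + 1))]))
  choose q hq using hseq
  have hmem : ∀ n, (q n : ℝ) ∈ Ioo a b := fun n ↦
    ⟨hr.1.trans (hq n).1, lt_of_lt_of_le (hq n).2 (min_le_left _ _)⟩
  have htend : Tendsto (fun n ↦ (q n : ℝ)) atTop (𝓝 r) := by
    have h2 : Tendsto (fun n : ℕ ↦ r + 1 / ((n : ℝ) + 1)) atTop (𝓝 r) := by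
      simpa using (tendsto_const_nhds (x := r)).add
        (tendsto_one_div_add_atTop_nhds_zero_nat (𝕜 := ℝ))
    exact tendsto_of_tendsto_of_tendsto_of_le_of_le tendsto_const_nhds h2
      (fun n ↦ (hq n).1.le) (fun n ↦ (lt_of_lt_of_le (hq n).2 (min_le_right _ _)).le)
  have htendW : Tendsto (fun n ↦ (q n : ℝ)) atTop (𝓝[Ioo a b] r) :=
    tendsto_nhdsWithin_iff.2 ⟨htend, Eventually.of_forall hmem⟩
  have hfl : Tendsto (fun n ↦ f (q n)) atTop (𝓝 (f r)) := (hf r hr).tendsto.comp htendW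
  have hgl : Tendsto (fun n ↦ g (q n)) atTop (𝓝 (g r)) := (hg r hr).tendsto.comp htendW
  have heq : (fun n ↦ f (q n)) = fun n ↦ g (q n) := funext fun n ↦ h (q n) (hmem n)
  rw [heq] at hfl
  exact tendsto_nhds_unique hfl hgl

/-! ### The main statement -/

section Main

variable [h2π : Fact (0 < 2 * π)]

omit h2π in
/-- `F = Φ ∘ κ_a ∈ C⁴` for `Φ ∈ C⁴`. [folklore] -/
theorem contDiff_four_starPull (a : ℝ) {Φ : E4 → ℝ} (hΦ : ContDiff ℝ 4 Φ) :
    ContDiff ℝ 4 (starPull a Φ) :=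
  hΦ.comp (contDiff_starChart a)

omit h2π in
/-- `ContDiff ℝ 3 G → ContDiff ℝ 2 (∂_i G)`. [folklore] -/
theorem contDiff_two_dir {G : E4 → ℝ} (hG : ContDiff ℝ 3 G) (i : Fin 4) :
    ContDiff ℝ 2 (dir i G) :=
  contDiff_dir (n := 2) (by norm_num; exact hG) i

omit h2π in
/-- `ContDiff ℝ 4 G → ContDiff ℝ 3 (∂_i G)`. [folklore] -/
theorem contDiff_three_dir {G : E4 → ℝ} (hG : ContDiff ℝ 4 G) (i : Fin 4) :
    ContDiff ℝ 3 (dir i G) :=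
  contDiff_dir (n := 3) (by norm_num; exact hG) i

omit h2π in
/-- `Φ ∈ C⁴ ⇒ Φ ∈ C²`. [folklore] -/
theorem contDiff_two_of_four {Φ : E4 → ℝ} (hΦ : ContDiff ℝ 4 Φ) : ContDiff ℝ 2 Φ :=
  hΦ.of_le (by norm_num)

section Regularity

variable (a : ℝ) {Φ : E4 → ℝ} (hΦ : ContDiff ℝ 4 Φ)
include hΦ

omit h2π in
/-- `∂₁F ∈ C²`. [folklore] -/
theorem contDiff_two_D1 : ContDiff ℝ 2 (dir 1 (starPull a Φ)) :=
  contDiff_two_dir ((contDiff_four_starPull a hΦ).of_le (by norm_num)) 1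

omit h2π in
/-- `∂₁²F ∈ C²`. [folklore] -/
theorem contDiff_two_D2 : ContDiff ℝ 2 (dir 1 (dir 1 (starPull a Φ))) :=
  contDiff_two_dir (contDiff_three_dir (contDiff_four_starPull a hΦ) 1) 1

omit h2π in
/-- `∂₁³F ∈ C¹`. [folklore] -/
theorem contDiff_one_D3 : ContDiff ℝ 1 (dir 1 (dir 1 (dir 1 (starPull a Φ)))) :=
  contDiff_one_dir (contDiff_two_D2 a hΦ) 1

omit h2π in
/-- Continuity of `∂₁⁴F`. [folklore] -/
theorem continuous_D4 : Continuous (dir 1 (dir 1 (dir 1 (dir 1 (starPull a Φ))))) :=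
  continuous_dir (contDiff_one_D3 a hΦ) one_ne_zero 1

end Regularity

/-- **Carter's radial ODE in the star chart with `C²` coefficients for a.e. frequency** (DRSR
Prop. 5.2.1 & Lemma 5.4.1, `*`-chart form). See the module docstring for the statement.
[cite: DafermosRodnianskiShlapentokhrothman2014, Prop. 5.2.1, Lemma 5.4.1] -/
theorem carter_radial_ode_star (a M : ℝ) {Φ : E4 → ℝ} (hΦ : ContDiff ℝ 4 Φ) {W : E4 → ℝ}
    (hW2 : ContDiff ℝ 2 W) (hW : ∀ q : E4, 0 < q 1 → sin (q 2) ≠ 0 → W q = sepRHS a M Φ q)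
    -- time square-integrability of the source and its `∂₁`, with a uniform bound for `∂₁²W`
    (hIW : ∀ r, TimeSqInt W hW2.continuous r)
    (hIW1 : ∀ r, TimeSqInt (dir 1 W) (contDiff_one_dir hW2 1).continuous r)
    {cW : ℝ} (hcW : 0 ≤ cW)
    (hBW : ∀ r, ∫⁻ t, ‖angSlice (dir 1 (dir 1 W))
      (continuous_dir (contDiff_one_dir hW2 1) one_ne_zero 1) t r‖ₑ ^ 2 ≤ ENNReal.ofReal (cW ^ 2))
    -- time square-integrability of `F, ∂₀F, ∂₁F, ∂₁²F, ∂₁³F` and of the atoms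
    (hIF : ∀ r, TimeSqInt (starPull a Φ)
      (contDiff_two_starPull a (contDiff_two_of_four hΦ)).continuous r)
    (hI0 : ∀ r, TimeSqInt (dir 0 (starPull a Φ))
      (continuous_dir (contDiff_one_starPull a (contDiff_two_of_four hΦ)) one_ne_zero 0) r)
    (hJ1 : ∀ r, TimeSqInt (dir 1 (starPull a Φ)) (contDiff_two_D1 a hΦ).continuous r)
    (hJ2 : ∀ r, TimeSqInt (dir 1 (dir 1 (starPull a Φ))) (contDiff_two_D2 a hΦ).continuous r)
    (hJ3 : ∀ r, TimeSqInt (dir 1 (dir 1 (dir 1 (starPull a Φ))))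
      (contDiff_one_D3 a hΦ).continuous r)
    (hIA : ∀ i r, TimeSqInt (sepAtom a Φ i) (continuous_sepAtom a (contDiff_two_of_four hΦ) i) r)
    -- uniform-in-`r` bounds for `∂₁²F, ∂₁³F, ∂₁⁴F`
    {c : ℝ} (hc : 0 ≤ c)
    (hB2 : ∀ r, ∫⁻ t, ‖angSlice (dir 1 (dir 1 (starPull a Φ))) (contDiff_two_D2 a hΦ).continuous
      t r‖ₑ ^ 2 ≤ ENNReal.ofReal (c ^ 2))
    (hB3 : ∀ r, ∫⁻ t, ‖angSlice (dir 1 (dir 1 (dir 1 (starPull a Φ))))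
      (contDiff_one_D3 a hΦ).continuous t r‖ₑ ^ 2 ≤ ENNReal.ofReal (c ^ 2))
    (hB4 : ∀ r, ∫⁻ t, ‖angSlice (dir 1 (dir 1 (dir 1 (dir 1 (starPull a Φ)))))
      (continuous_D4 a hΦ) t r‖ₑ ^ 2 ≤ ENNReal.ofReal (c ^ 2))
    {r_a r_b : ℝ} (hra : 0 < r_a) (hab : r_a ≤ r_b) :
    ∃ u u₁ u₂ w : ℝ → ℝ → AngSpace,
      (∀ r ∈ Icc r_a r_b, u r =ᵐ[volume]
        (freqLp (starPull a Φ) (contDiff_two_starPull a (contDiff_two_of_four hΦ)).continuous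
          hIF r : ℝ → AngSpace)) ∧
      (∀ r ∈ Icc r_a r_b, w r =ᵐ[volume] (freqLp W hW2.continuous hIW r : ℝ → AngSpace)) ∧
      ∀ᵐ ξ ∂volume,
        ContinuousOn (fun r ↦ w r ξ) (Icc r_a r_b) ∧ ContinuousOn (fun r ↦ u₂ r ξ) (Icc r_a r_b) ∧
        (∀ r ∈ Ioo r_a r_b, HasDerivAt (fun r ↦ u₁ r ξ) (u₂ r ξ) r) ∧
        (∀ r ∈ Ioo r_a r_b, HasDerivAt (fun r ↦ u r ξ) (u₁ r ξ) r) ∧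
        ∀ q : OblateSphereIndex (a * (-2 * π * ξ)), ∀ r ∈ Ioo r_a r_b,
          ((r ^ 2 - 2 * M * r + a ^ 2 : ℝ) : ℂ) *
              ⟪oblateSphereBasis (2 * π) (a * (-2 * π * ξ)) q, u₂ r ξ⟫_ℂ +
            ((2 * (r - M) : ℝ) + 2 * Complex.I * (a * q.1 - 2 * M * r * (-2 * π * ξ))) *
              ⟪oblateSphereBasis (2 * π) (a * (-2 * π * ξ)) q, u₁ r ξ⟫_ℂ +
            (((-2 * π * ξ) ^ 2 * (r ^ 2 + 2 * M * r) : ℝ) - 2 * Complex.I * M * (-2 * π * ξ) -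
                (oblateSphereEig (a * (-2 * π * ξ)) q : ℂ)) *
              ⟪oblateSphereBasis (2 * π) (a * (-2 * π * ξ)) q, u r ξ⟫_ℂ =
          ⟪oblateSphereBasis (2 * π) (a * (-2 * π * ξ)) q, w r ξ⟫_ℂ := by
  have hΦ2 : ContDiff ℝ 2 Φ := contDiff_two_of_four hΦ
  have hF2 : ContDiff ℝ 2 (starPull a Φ) := contDiff_two_starPull a hΦ2
  -- (1) regularity of `freqLp F` in `r`
  have hU : ∀ r, HasDerivAt (freqLp (starPull a Φ) hF2.continuous hIF)
      (freqLp (dir 1 (starPull a Φ)) (contDiff_two_D1 a hΦ).continuous hJ1 r) r :=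
    fun r ↦ hasDerivAt_freqLp hF2 hIF hJ1 hc hB2 r
  have hU₁ : ∀ r, HasDerivAt (freqLp (dir 1 (starPull a Φ)) (contDiff_two_D1 a hΦ).continuous hJ1)
      (freqLp (dir 1 (dir 1 (starPull a Φ))) (contDiff_two_D2 a hΦ).continuous hJ2 r) r :=
    fun r ↦ hasDerivAt_freqLp (contDiff_two_D1 a hΦ) hJ1 hJ2 hc hB3 r
  have hU₂ : ∀ r, HasDerivAt
      (freqLp (dir 1 (dir 1 (starPull a Φ))) (contDiff_two_D2 a hΦ).continuous hJ2)
      (freqLp (dir 1 (dir 1 (dir 1 (starPull a Φ)))) (contDiff_one_D3 a hΦ).continuous hJ3 r) r :=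
    fun r ↦ hasDerivAt_freqLp (contDiff_two_D2 a hΦ) hJ2 hJ3 hc hB4 r
  have hU₃ : Continuous
      (freqLp (dir 1 (dir 1 (dir 1 (starPull a Φ)))) (contDiff_one_D3 a hΦ).continuous hJ3) :=
    continuous_freqLp (contDiff_one_D3 a hΦ) hJ3 hc hB4
  -- (2) representatives, `C²` in `r` for a.e. `ξ`
  letI : MeasurableSpace AngSpace := borel _
  haveI : BorelSpace AngSpace := ⟨rfl⟩
  haveI : Fact ((2 : ℝ≥0∞) ≠ ∞) := ⟨ENNReal.ofNat_ne_top⟩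
  obtain ⟨u, u₁, u₂, -, -, -, hru, hru₁, hru₂, hreg⟩ :=
    exists_rep_deriv_two (μ := (volume : Measure ℝ)) hab hU hU₁ hU₂ hU₃
  -- (3) a continuous-in-`r` representative of the source
  have hWU : ∀ r, HasDerivAt (freqLp W hW2.continuous hIW)
      (freqLp (dir 1 W) (contDiff_one_dir hW2 1).continuous hIW1 r) r :=
    fun r ↦ hasDerivAt_freqLp hW2 hIW hIW1 hcW hBW r
  have hWc1 : Continuous (freqLp (dir 1 W) (contDiff_one_dir hW2 1).continuous hIW1) :=
    continuous_freqLp (contDiff_one_dir hW2 1) hIW1 hcW hBW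
  obtain ⟨w, -, hrw, hwc⟩ := exists_continuousOn_rep (μ := (volume : Measure ℝ)) hab hWU hWc1
  refine ⟨u, u₁, u₂, w, hru, hrw, ?_⟩
  -- (4) the identity at every rational radius, for a.e. `ξ`
  have hrat : ∀ᵐ ξ ∂volume, ∀ s : ℚ, (s : ℝ) ∈ Ioo r_a r_b →
      ∀ q : OblateSphereIndex (a * (-2 * π * ξ)),
        (((s : ℝ) ^ 2 - 2 * M * s + a ^ 2 : ℝ) : ℂ) *
              ⟪oblateSphereBasis (2 * π) (a * (-2 * π * ξ)) q, u₂ s ξ⟫_ℂ +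
            ((2 * ((s : ℝ) - M) : ℝ) + 2 * Complex.I * (a * q.1 - 2 * M * (s : ℝ) * (-2 * π * ξ))) *
              ⟪oblateSphereBasis (2 * π) (a * (-2 * π * ξ)) q, u₁ s ξ⟫_ℂ +
            (((-2 * π * ξ) ^ 2 * ((s : ℝ) ^ 2 + 2 * M * s) : ℝ) - 2 * Complex.I * M * (-2 * π * ξ) -
                (oblateSphereEig (a * (-2 * π * ξ)) q : ℂ)) *
              ⟪oblateSphereBasis (2 * π) (a * (-2 * π * ξ)) q, u s ξ⟫_ℂ =
          ⟪oblateSphereBasis (2 * π) (a * (-2 * π * ξ)) q, w s ξ⟫_ℂ := by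
    refine ae_all_iff.2 fun s ↦ ?_
    by_cases hs : (s : ℝ) ∈ Ioo r_a r_b
    · have hs' : (s : ℝ) ∈ Icc r_a r_b := Ioo_subset_Icc_self hs
      have hpos : 0 < (s : ℝ) := hra.trans hs.1
      filter_upwards [carter_frequency_identity a M hΦ2 hW2.continuous hW hIW hIF hI0 hJ1 hIA hpos,
        hru _ hs', hru₁ _ hs', hru₂ _ hs', hrw _ hs'] with ξ hid h0 h1 h2 h3
      intro _ q
      rw [h0, h1, h2, h3]
      exact hid q
    · exact ae_of_all _ fun ξ h' ↦ absurd h' hs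
  -- (5) all radii, by continuity in `r`
  filter_upwards [hreg, hwc, hrat] with ξ hξ hwξ hQ
  obtain ⟨hc2, hd1, hd0⟩ := hξ
  refine ⟨hwξ, hc2, hd1, hd0, fun q ↦ ?_⟩
  have hcu : ContinuousOn (fun r ↦ u r ξ) (Ioo r_a r_b) :=
    fun r hr ↦ (hd0 r hr).continuousAt.continuousWithinAt
  have hcu₁ : ContinuousOn (fun r ↦ u₁ r ξ) (Ioo r_a r_b) :=
    fun r hr ↦ (hd1 r hr).continuousAt.continuousWithinAt
  have hcu₂ : ContinuousOn (fun r ↦ u₂ r ξ) (Ioo r_a r_b) := hc2.mono Ioo_subset_Icc_self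
  have hcw' : ContinuousOn (fun r ↦ w r ξ) (Ioo r_a r_b) := hwξ.mono Ioo_subset_Icc_self
  have hinner : ∀ {v : ℝ → AngSpace}, ContinuousOn v (Ioo r_a r_b) →
      ContinuousOn (fun r ↦ ⟪oblateSphereBasis (2 * π) (a * (-2 * π * ξ)) q, v r⟫_ℂ)
        (Ioo r_a r_b) := fun hv ↦
    continuous_inner.comp_continuousOn (continuousOn_const.prodMk hv)
  refine eqOn_Ioo_of_rat ?_ (hinner hcw') (fun s hs ↦ hQ s hs q)
  have k1 : Continuous fun r : ℝ ↦ ((r ^ 2 - 2 * M * r + a ^ 2 : ℝ) : ℂ) := by fun_prop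
  have k2 : Continuous fun r : ℝ ↦
      ((2 * (r - M) : ℝ) : ℂ) + 2 * Complex.I * (a * q.1 - 2 * M * r * (-2 * π * ξ)) := by fun_prop
  have k3 : Continuous fun r : ℝ ↦
      (((-2 * π * ξ) ^ 2 * (r ^ 2 + 2 * M * r) : ℝ) : ℂ) - 2 * Complex.I * M * (-2 * π * ξ) -
        (oblateSphereEig (a * (-2 * π * ξ)) q : ℂ) := by fun_prop
  exact ((k1.continuousOn.mul (hinner hcu₂)).add (k2.continuousOn.mul (hinner hcu₁))).add
    (k3.continuousOn.mul (hinner hcu))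

end Main

end Kerr

end Literature.Geometry.Lorentzian
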